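import Summits.Ventures.DiscreteObjects.PP12.OrderThirteenPlace

/-!
# PP(12), order-13 cell: the decidable side conditions of a placement run (definitions only)
Framing: lottery ticket; floor = certified bounds/negative ranges.

Cell pub-namedobj (venture DiscreteObjects), target (M), designs gen 21. For a placement run `Place13.placeK cells 0 0 0 0` (OrderThirteenPlace) to refute a complete
shape ASSIGNMENT `A` of the shape search (`Shape13.searchK`, field `5(11s+t)` = shape + 1), the listed cells must be cells (`s, t < 11`) carrying the listed shapes in
`A` (`cellsOK`) and be pairwise distinct (`nodupCells`, a plain Boolean recursion — `List.Nodup` by `decide` is too deep for the kernel in bulk). Both are decided per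
structure in the run files (OrderThirteenPlaceRuns…); their meaning is in OrderThirteenPlaceLeaf. Pure definitions; no `sorry`, no axioms.
-/

namespace Summit.Ventures.DiscreteObjects.PP12

namespace Place13

open Shape13

/-- the cells listed for a placement run are cells (`s, t < 11`) to which the assignment `A` gives the listed shapes (field `5(11s+t)` = shape + 1) -/
def cellsOK (A : ℕ) (cells : List (ℕ × ℕ × ℕ)) : Bool :=
  cells.all fun c => Nat.blt c.1 11 && Nat.blt c.2.1 11 && Nat.beq (aAt A (5 * (11 * c.1 + c.2.1))) (c.2.2 + 1)

/-- is the cell `(a, b)` among the listed cells? -/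
def memP (a b : ℕ) : List (ℕ × ℕ × ℕ) → Bool
  | [] => false
  | c :: cs => (Nat.beq c.1 a && Nat.beq c.2.1 b) || memP a b cs

/-- the listed cells are pairwise distinct -/
def nodupCells : List (ℕ × ℕ × ℕ) → Bool
  | [] => true
  | c :: cs => !(memP c.1 c.2.1 cs) && nodupCells cs

end Place13

end Summit.Ventures.DiscreteObjects.PP12
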